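import Literature.AlgebraicGeometry.Crystalline.HuComplexes
import Literature.AlgebraicGeometry.Crystalline.SheafHypercohomology
import Literature.AlgebraicGeometry.KTheory.GrothendieckGroup
import Literature.AlgebraicGeometry.Motives.CrystallineRealization
import HarnessLib

/-!
# X. Hu's infinitesimal `K₀`-lifting criterion over truncated Witt vectors (named facts)

For a perfect field `k` of characteristic `p` and a smooth proper `𝒳/W(k)` of relative dimension
`d` (tree: `Motives.WittScheme.IsSmoothProperModel d 𝒳`; thickenings `X_n = 𝒳 ⊗ W/pⁿ`,
`Motives.WittScheme.thickening 𝒳 n`; Grothendieck groups `KTheory.KZero`), X. Hu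
(arXiv:2507.12458, 2025) proves, for `n > m ≥ 1`:

* (Thm. 1.2 = Prop. 11.1(i), p. 4 / p. 65; `d ≤ p − 6`) a class `ξ ∈ K₀(X_m)` lifts to `K₀(X_n)` iff
  it is killed by the HODGE OBSTRUCTION map
  `ob : K₀(X_m) → ⊕_{r=1}^{d−1} ℍ^{2r}(X_1, p^{r,m}_{r,n}Ω•_{X•})` (a homomorphism: the composite of
  the Chern character into `⊕ H^{2r}(X_1, ℤ_{X_m}(r))[1/r!]` and the map of the fundamental triangle
  `p^{r,m}_{r,n}Ω•[−1] → ℤ_{X_n}(r) → ℤ_{X_m}(r) → p^{r,m}_{r,n}Ω•`, (1.5)/(8.5), Def. 8.3);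
* (Cor. 10.5(i), p. 52, `i = 0`, `0 ≤ p − 5 − d`) the relative Chern character
  `ch : K₀(X_n, X_m) ≅ ⊕_{r=1}^{p−1} ℍ^{2r−1}(X_1, p^{r,m}_{r,n}Ω•_{X•})` is an isomorphism; with the
  exact sequence `K₀(X_n, X_m) → K₀(X_n) → K₀(X_m)` of the nilpotent thickening (used in the proof of
  Prop. 11.1, p. 65) its image in `K₀(X_n)` is the kernel of the restriction;
* (Prop. 9.6, p. 47) the (relative) Chern classes are compatible with the change of levels
  `n ≥ n'` (resp. `(n, m) ≥ (n', m')`), and the complexes `p^{r,m}_{r,n}Ω•`, the triangles and the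
  cones of Def. 8.3 are built functorially from the reductions `p(r)Ω•_{X_{n'}} → p(r)Ω•_{X_n}`.

This file VENDORS these statements as two named facts over the tree's carriers — they are NOT
proved here (the proofs rest on Brun's isomorphism, topological cyclic homology and a long mod-`p`
analysis, 138 pp.), and the source is an unrefereed preprint (`@[claim … "under-review"]`, D-0012):

* `HuKZeroLiftingCriterion` — existence of a family of homomorphisms `ob m n` with (a) the lifting
  criterion and (b) compatibility with the reductions in `n`;
* `HuKZeroKernelPresentation` — existence of a family of homomorphisms
  `ρ m n : ⊕_{r=1}^{p−1} ℍ^{2r−1}(p^{r,m}_{r,n}Ω•) → K₀(X_n)` with (a) image = kernel of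
  `K₀(X_n) → K₀(X_m)` and (b) compatibility with the reductions in `n`.

CARRIERS AND PACKAGING (read before citing).
(α) Hu's `p^{r,m}_{r,n}Ω•_{X•}` (Def. 8.2) is the tree's `Crystalline.huComplexInt 𝒳 p r m n`
(`Crystalline/HuComplexes`: the staircase image `p^{(r−•)m}` of the staircase reduction
`Ω•_{𝒳/W} / p^{(r−•)n}` of the algebraic de Rham complex of `𝒳/W`, extended by zero to `ℤ`); Hu's
terms `p^{(r−j)m}Ωʲ_{X_{(r−j)n}/W_{(r−j)n}}` are these images because `Ωʲ_{X_l/W_l} = Ωʲ_{𝒳/W} ⊗ W/pˡ`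
for the smooth lift `𝒳` (and `Ωʲ_{𝒳/W}` is `p`-torsion free, cf.
`Algebra/Homology/StaircaseTorsionFree`). (β) Hu's hypercohomology is on `|X_1|` (Nisnevich or
Zariski — equal here, the terms being quasi-coherent with additive differentials); the tree's
`Crystalline.SheafHypercohomology` is taken on `|𝒳|` (Zariski), where the complexes are supported on
the closed special fibre, so the groups agree (`ℍ•(|𝒳|, i_* K) = ℍ•(|X_1|, K)`). (γ) The direct sum
`⊕_{r}` is rendered as the product over the finite index set (`Π r : {r // …}`). (δ) Clause (b) of
each fact (compatibility in `n`) packages Prop. 9.6 with the functoriality of Def. 8.2–8.3 in the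
level; it is what `lim_n`-arguments (Bloch–Esnault–Kerz-style) consume. (ε) Hypotheses: the source
needs `X•` smooth separated of finite type over `W•(k)` (no properness); we state the special case of
the tree's smooth proper models `𝒳/W` (`TODO(general form)`: `p`-adic smooth formal schemes, higher
`K_i` (Prop. 11.1(ii), Cor. 10.5(i) for `i ≤ p−5−d`)). (ζ) `ob`, `ρ` are asserted to EXIST with the
printed properties; the source's specific maps (via `ch` and `ℤ_{X_n}(r)`) are not named in the tree.
(η) WHICH `K₀`: the source's `K(X_n)`, `K_i(X_n, X_m)` are Thomason–Trobaugh `K`-groups of the scheme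
`X_n` (perfect complexes; [ThT90] is its reference for the descent spectral sequence in the proof of
Cor. 10.5), whereas the tree's `KTheory.KZero` is the Grothendieck group of the exact category of
vector bundles (Fulton's `K⁰`). For the schemes quantified over here the two agree: `𝒳` is separated,
noetherian and regular (smooth over `W(k)`), hence has an ample family of line bundles, and so has
its closed subscheme `X_n` (restrict the family); for a quasi-compact separated scheme with an ample
family of line bundles `K(Vect X) ≃ K(X)` (Thomason–Trobaugh, Cor. 3.9; Schlichting's lecture notes,
§3.4.7 and Prop. 3.4.8: "Every separated regular noetherian scheme has an ample family of line
bundles", "Any … closed subscheme of a scheme with an ample family of line bundles has itself an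
ample family", "`IK Vect(X) ≃ IK(X)`"), in particular `K₀(Vect X_n) = K₀^{TT}(X_n)`, and the exact
sequence `K₀(X_n, X_m) → K₀(X_n) → K₀(X_m)` of the source is a statement about the tree's `KZero`.
[cite: Schlichting2011HigherKTheory, §3.4.7, Prop. 3.4.8] [cite: ThomasonTrobaugh1990, Cor. 3.9]

Use: crux `FormalLiftingFromClassLifting` of route `HodgeConjecture/PadicSemiregularLift` (idea card
`hu-infinitesimal-obstruction`): (2_K) kernel-tower surjectivity from `HuKZeroKernelPresentation` +
surjectivity of the coherent transitions; level-wise (1_K) from `HuKZeroLiftingCriterion` + torsion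
freeness of `lim_n ℍ^{2r}`. Proved companions: `KTheory/HuInfinitesimalKZeroProofs` (functoriality of
the level reductions, long exact sequences of Hu's three-term sequences) and
`KTheory/HuKZeroRationalInjectivity` (the hypercohomology carriers are `p`-power torsion; granted the
facts, `K₀(X_n)_ℚ → K₀(X_m)_ℚ` is bijective for `1 ≤ m < n` — the finite-level statements are
rationally trivial, the content being in `lim_n`) and `KTheory/HuComplexDimensionVanishing`
(`dim |𝒳| ≤ d + 1` for a smooth proper model of relative dimension `d`, hence
`ℍⁱ(p^{r,M}_{r,N}Ω•) = 0` for `i > r + d`: the components `r > d + 1` of the source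
`⊕_{r=1}^{p−1} ℍ^{2r−1}` of `HuKZeroKernelPresentation` vanish — the printed dimension step of the
proof of Prop. 11.1, p. 65, one value of `r` weaker on `|𝒳|` than on `|X_1|` (caveat (β)) — and the
odd level transitions are onto in that range), sharpened in `KTheory/HuComplexSupportedVanishing` to
the printed range `i > (r − 1) + d` (the terms of `p^{r,M}_{r,N}Ω•` are supported on the special-fibre
locus `V(p)`, of dimension `≤ d` — `Dimension/SmoothFibreDimension` — and Grothendieck vanishing with
supports applies termwise): the components `r > d` vanish and the odd transitions are onto for
`d < r`, so on the carriers of this file caveat (β) costs nothing.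

TOWARDS A DISCHARGE OF `HuKZeroKernelPresentation` (what is proved of its two ingredients). The source's
`ρ` is `(K₀(X_n, X_m) → K₀(X_n)) ∘ ch⁻¹`: (S1) the relative Chern character isomorphism of
Cor. 10.5(i) and (S2) the exact sequence `K₀(X_n, X_m) → K₀(X_n) → K₀(X_m)`. Of (S1) only the
homological-algebra step Lemma 10.2 is in the tree (`Algebra/Homology/BoundedTorsionModPComparison`).
(S2) is a THEOREM for Grayson's PRESENTED relative group `K₀Ω[i^*]` of the restriction
`i^* : Vect(X_n) → Vect(X_m)` (D. Grayson, arXiv:1310.8644, Def. 1–5, Thm. 7: the five-term sequence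
`K₁𝓜 → K₁𝓝 → K₀Ω[F] → K₀𝓜 → K₀𝓝` by elementary means): `KTheory/HellerCriterion` (Heller's criterion,
Grayson Lemma 17 / Cor. 18, for `KZero`), `KTheory/EulerCharacteristic` and
`KTheory/PullbackAcyclicVBComplex` (Euler characteristics of bounded complexes of vector bundles,
quasi-isomorphism invariance, pull-backs), `KTheory/GraysonRelativeKZero` (`RelKZero f = K₀Ω[f^*]` and
`RelKZero.range_toKZero_eq_ker : im(K₀Ω[f^*] → K₀(X)) = ker(f^*)`), and
`KTheory/HuKernelPresentationViaGrayson` (`huKZeroKernelPresentation_of_surjective`: the fact follows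
from surjections `⊕_{r=1}^{p−1} ℍ^{2r−1}(p^{r,m}_{r,n}Ω•) ↠ K₀Ω[i_{m,n}^*]` natural in `n`). The
identification of `K₀Ω[i^*]` with the Thomason–Trobaugh relative `K₀` of the source is Grayson's
Conjecture 6 and is not asserted anywhere in the tree.
-/

noncomputable section

namespace Literature.AlgebraicGeometry.KTheory

open CategoryTheory _root_.AlgebraicGeometry _root_.TopologicalSpace
  Literature.AlgebraicGeometry.Motives Literature.AlgebraicGeometry.Crystalline
  Literature.Algebra.Homology

/-! ### The targets: hypercohomology of Hu's complexes -/

section Targets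

variable (p : ℕ) [Fact p.Prime] (k : Type) [CommRing k] (𝒳 : SchemeOver (WittVector p k))

/-- The hypercohomology group `ℍⁱ(X, p^{r,m}_{r,n}Ω•)` of Hu's complex (on `|𝒳|`, Zariski; see (β) in
the module docstring), in the tree's sense `Crystalline.SheafHypercohomology`. [folklore] -/
abbrev huH (r m n : ℕ) (i : ℤ) : Type :=
  SheafHypercohomology.{0} (Opens.grothendieckTopology 𝒳.left) (huComplexInt 𝒳 (p : ℤ) r m n) i

/-- The reduction `ℍⁱ(p^{r,m}_{r,n'}Ω•) → ℍⁱ(p^{r,m}_{r,n}Ω•)` for `n ≤ n'`, induced by Hu's reduction map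
of complexes (`Crystalline.huComplexIntReduce`). [folklore] -/
abbrev huHReduce (r m : ℕ) {n n' : ℕ} (h : n ≤ n') (i : ℤ) : huH p k 𝒳 r m n' i →+ huH p k 𝒳 r m n i :=
  HyperExt.map (huComplexIntReduce 𝒳 (p : ℤ) r m h) i

/-- The target `⊕_{r=1}^{d−1} ℍ^{2r}(X, p^{r,m}_{r,n}Ω•)` of Hu's Hodge obstruction map at levels
`(m, n)` (Thm. 1.2), as a product over `r ∈ [1, d−1]`. [cite: Hu2025TruncatedWitt, Thm. 1.2 (p. 4)] -/
abbrev HuObstructionTarget (d m n : ℕ) : Type :=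
  ∀ r : {r : ℕ // 1 ≤ r ∧ r < d}, huH p k 𝒳 r.1 m n (2 * (r.1 : ℤ))

/-- The source `⊕_{r=1}^{p−1} ℍ^{2r−1}(X, p^{r,m}_{r,n}Ω•)` of Hu's relative Chern character isomorphism
for `K₀(X_n, X_m)` (Cor. 10.5(i), `i = 0`), as a product over `r ∈ [1, p−1]`.
[cite: Hu2025TruncatedWitt, Cor. 10.5(i) (p. 52)] -/
abbrev HuKernelSource (m n : ℕ) : Type :=
  ∀ r : {r : ℕ // 1 ≤ r ∧ r < p}, huH p k 𝒳 r.1 m n (2 * (r.1 : ℤ) - 1)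

variable {p k 𝒳}

/-- The reduction on obstruction targets, componentwise `huHReduce`. [folklore] -/
def HuObstructionTarget.reduce (d m : ℕ) {n n' : ℕ} (h : n ≤ n') :
    HuObstructionTarget p k 𝒳 d m n' →+ HuObstructionTarget p k 𝒳 d m n where
  toFun x r := huHReduce p k 𝒳 r.1 m h _ (x r)
  map_zero' := funext fun _ ↦ map_zero _
  map_add' _ _ := funext fun _ ↦ map_add _ _ _

/-- The reduction on kernel sources, componentwise `huHReduce`. [folklore] -/
def HuKernelSource.reduce (m : ℕ) {n n' : ℕ} (h : n ≤ n') :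
    HuKernelSource p k 𝒳 m n' →+ HuKernelSource p k 𝒳 m n where
  toFun x r := huHReduce p k 𝒳 r.1 m h _ (x r)
  map_zero' := funext fun _ ↦ map_zero _
  map_add' _ _ := funext fun _ ↦ map_add _ _ _

end Targets

/-! ### The named facts -/

open WittScheme in
/-- **X. Hu's infinitesimal `K₀`-lifting criterion** (arXiv:2507.12458, Thm. 1.2 = Prop. 11.1(i),
with the level-compatibility of Prop. 9.6 / Def. 8.3). For `k` perfect of characteristic `p`, `𝒳/W(k)`
a smooth proper model of relative dimension `d` with `d + 6 ≤ p`, there is a family of group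
homomorphisms ("Hodge obstruction maps")
`ob m n : K₀(X_m) → ⊕_{r=1}^{d−1} ℍ^{2r}(X, p^{r,m}_{r,n}Ω•)` (`X_l = thickening 𝒳 l`) such that
(a) for `1 ≤ m < n`, a class `ξ ∈ K₀(X_m)` is the restriction of a class in `K₀(X_n)` iff
`ob m n ξ = 0` (Thm. 1.2, p. 4: "a class `ξ ∈ K₀(X_m)` lifts to `K₀(X_n)` if and only if it is sent to
`0` by a Hodge obstruction map"), and (b) for `1 ≤ m < n ≤ n'`, `ob m n = (reduction) ∘ ob m n'`
(packaging of Prop. 9.6(i) and the functoriality of the triangle (8.5) in the level — caveat (δ) of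
the module docstring). Carriers and the `|X_1|`-vs-`|𝒳|` convention: caveats (α)–(γ); hypotheses:
caveat (ε). A CLAIM of an unrefereed preprint; not proved here.
[cite: Hu2025TruncatedWitt, Thm. 1.2 (p. 4), Prop. 11.1(i) (p. 65), Prop. 9.6 (p. 47), Def. 8.2–8.3 (p. 38)] -/
@[claim "Hu2025TruncatedWitt" "under-review"]
def HuKZeroLiftingCriterion : Prop :=
  ∀ (p : ℕ) [Fact p.Prime] (k : Type) [Field k] [CharP k p] [PerfectRing k p] (d : ℕ)
    (𝒳 : SchemeOver (WittVector p k)), IsSmoothProperModel d 𝒳 → d + 6 ≤ p →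
    ∃ ob : ∀ m n : ℕ, KZero (thickening 𝒳 m).left →+ HuObstructionTarget p k 𝒳 d m n,
      (∀ (m n : ℕ) (hmn : m < n), 1 ≤ m → ∀ ξ : KZero (thickening 𝒳 m).left,
          (∃ ξ' : KZero (thickening 𝒳 n).left, KZero.map (thickeningMap 𝒳 hmn.le) ξ' = ξ) ↔
            ob m n ξ = 0) ∧
      (∀ (m n n' : ℕ), 1 ≤ m → m < n → ∀ (hnn' : n ≤ n') (ξ : KZero (thickening 𝒳 m).left),
          ob m n ξ = HuObstructionTarget.reduce d m hnn' (ob m n' ξ))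

open WittScheme in
/-- **X. Hu's presentation of the kernel of `K₀(X_n) → K₀(X_m)` by hypercohomology**
(arXiv:2507.12458, Cor. 10.5(i) for `i = 0`, with the exact sequence `K₀(X_n, X_m) → K₀(X_n) →
K₀(X_m)` used on p. 65 and the level-compatibility of Prop. 9.6(ii)). For `k` perfect of
characteristic `p`, `𝒳/W(k)` a smooth proper model of relative dimension `d` with `d + 5 ≤ p`, there is
a family of group homomorphisms `ρ m n : ⊕_{r=1}^{p−1} ℍ^{2r−1}(X, p^{r,m}_{r,n}Ω•) → K₀(X_n)` (the
relative Chern character isomorphism `K₀(X_n, X_m) ≅ ⊕ ℍ^{2r−1}` inverted and followed by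
`K₀(X_n, X_m) → K₀(X_n)`) such that (a) for `1 ≤ m < n`, a class of `K₀(X_n)` restricts to `0` in
`K₀(X_m)` iff it is in the image of `ρ m n` (Cor. 10.5(i): "the infinitesimal Chern character map …
is an isomorphism", `0 ≤ p − 5 − d`; exactness of the relative sequence), and (b) for
`1 ≤ m < n ≤ n'`, `(restriction X_{n'} → X_n) ∘ ρ m n' = ρ m n ∘ (reduction)` (Prop. 9.6(ii) +
naturality of the relative sequence — caveat (δ)). Carriers: caveats (α)–(γ); hypotheses: caveat (ε).
A CLAIM of an unrefereed preprint; not proved here.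
[cite: Hu2025TruncatedWitt, Cor. 10.5(i) (p. 52), Prop. 9.6(ii) (p. 47), proof of Prop. 11.1 (p. 65)] -/
@[claim "Hu2025TruncatedWitt" "under-review"]
def HuKZeroKernelPresentation : Prop :=
  ∀ (p : ℕ) [Fact p.Prime] (k : Type) [Field k] [CharP k p] [PerfectRing k p] (d : ℕ)
    (𝒳 : SchemeOver (WittVector p k)), IsSmoothProperModel d 𝒳 → d + 5 ≤ p →
    ∃ ρ : ∀ m n : ℕ, HuKernelSource p k 𝒳 m n →+ KZero (thickening 𝒳 n).left,
      (∀ (m n : ℕ) (hmn : m < n), 1 ≤ m → ∀ η : KZero (thickening 𝒳 n).left,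
          KZero.map (thickeningMap 𝒳 hmn.le) η = 0 ↔ ∃ x, ρ m n x = η) ∧
      (∀ (m n n' : ℕ), 1 ≤ m → m < n → ∀ (hnn' : n ≤ n') (x : HuKernelSource p k 𝒳 m n'),
          KZero.map (thickeningMap 𝒳 hnn') (ρ m n' x) = ρ m n (HuKernelSource.reduce m hnn' x))

end Literature.AlgebraicGeometry.KTheory

end
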